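import Literature.MathematicalPhysics.QuantumFieldTheory.BalabanImbrieJaffe1984to88.BIJ88DeltaLocSmallPlaquetteTorusCwt
import Literature.MathematicalPhysics.QuantumFieldTheory.BalabanImbrieJaffe1984to88.BIJ88NeumannPropagatorSmallFieldRegionSup

/-!
# `BalabanImbrieJaffe1984to88.BIJ88DeltaLocSmallPlaquetteRegionCwt` — T. Bałaban, J. Imbrie, A. Jaffe, *Effective action and cluster properties
of the abelian Higgs model*, Commun. Math. Phys. **114** (1988) 257–315 [BalabanImbrieJaffe1988], §2 (2.31) and (2.35) p. 263 [PDF 7]; [I] = Commun.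
Math. Phys. **97** (1985) 299–329 [BalabanImbrieJaffe1985], §7.3 p. 326 [PDF 28]: **(2.31) (operator and kernel forms) AND (2.35) FOR A GENERAL
REGION `Ω ⊂ T_η` AT A GENERAL SMALL-PLAQUETTE `U(1)` FIELD, FOR THE PRINTED TORUS DATA** — gen 22's `BIJ88DeltaLocSmallPlaquetteTorusCwt` takes
`Ω = T_η` (its HONEST SCOPE (i)); print p. 263: *"(2.31) for dist(x, Ω^c) ≧ O(r(e_k)) … for (2.31) we assume smoothness throughout the subset
Ω ⊂ T_η"*.  Here `Ω` is ANY union of `k`-blocks containing the reference box `Ω₀` of the localization data (so that every cube `□_α ⊆ Ω₀ ⊆ Ω`,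
p29's `cubeOf_subset`), and the (H1.10) input for `G_k(Ω,u)` AT EVERY ROW under the (7.3.1)-type plaquette smallness alone is p34 g18's
`BIJ88NeumannPropagatorSmallFieldRegionSup.decay110_smallPlaquette_region_uniform` (v1.1, p356532: their region member in the blockwise centred gauge
of [I] p. 326 *«by change of gauge»*), USED BY NAME.

statement-level skeleton of published theorems with citation tags; proofs where landed; nothing here is a claim about the Yang–Mills mass gap

PDFs held: `paper:balaban1988-cmp114-bij-abelian-higgs-effective-action` (journal page = PDF page + 256; p. 263 = PDF 7);
`paper:balaban1985-cmp97-bij-higgs-minimizers` (journal page = PDF page + 298; p. 326 = PDF 28).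

CITATION HEADER (lean-in-tree rule).  lit-balaban cell (HOME `run/shared/lean/pub/lit-balaban/`), Phase 2, proof seat **p31 gen 22** (unit
`lit-balaban-p31`, literature-prover-lit-balaban-p31-g22-0), free-target protocol G.5-34(d), TAKING #4 line HOME/STATUS.md 2026-08-23T07:08:04Z
(window → 07:30Z; stem check `SmallPlaquetteRegionCwt` = ∅; notices to r18 g25, p34 g18, p27 g37, p30 g28, r15).  Rows of `HOME/lit-balaban-r18/ROWS-C2.md` served (LOCATED
MEMBERS, cells only; heads unchanged; owner r18): **C2.Eq2.31**, **C2.Eq2.35** «general region `Ω ⊇ Ω₀`, general small-plaquette `u`»; r15's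
**C1.Eq7.3.1-7.3.2** (located); C2S14-CLOSURE front (α′)[region] consumed (p34's member BY NAME, «p34: mine» 07:15Z honoured — no copy here).  Files
USED BY NAME, nothing restated: p31 g20
`BIJ88DeltaLocClose235General` (`opClose231_gen`, `close231_kernel_gen`, `close235_gen`), gen 22 `BIJ88DeltaLocSmallPlaquetteTorusCwt`
(`smallness_of_threshold`, `rowHyp_ii_deep`, `rows_of_deep`; p355030), p34 g18 `BIJ88NeumannPropagatorSmallFieldRegionSup.decay110_smallPlaquette_region_uniform`
(v1.1 p356532), p27
`BIJ88NeumannPropagatorSmallFieldSupDecay.decay110_smallPlaquette_cube_uniform`, p30 `BIJ88NeumannPropagatorSmallFieldClose.close112_smallField_hC`,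
p29 `BIJ88LocWeights227Torus` (`cubeFam`, `lamFam`, `labels`, `cubeFam_fits`, `cubeOf_subset`, `rowHyp_i`, `rowHyp_iii`, `cutoff_eq_zero_of_le`,
`cutoff_mem_unitInterval`, `sum_abs_lamT_le_one`, `activeLabels`, `card_subtype_activeLabels_le`, `mem_activeLabels_of_ne_zero_of_deep`), r18
`BIJ88Close231RegularTorusCwt` (`deepRows`, `mem_deepRows`), r15/p11 `BIJ85AbelianStokes` (`plaqC`, `plaqC_eq_toC_plaqHol`), p27
`BIJ88NeumannPropagatorFlatDecayCube` (`cubeT`, `boxCoord`, `isBlockUnion_cubeT`), gen 15 `BIJ88DeltaLoc234Torus` (`gLocT`, `deltaLocT`, `deltaRegion`),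
`BIJ88NeumannPropagator227Torus.gBox`, p13 `BIJ88Cutoffs21.cutoff`, p38 `B5Ineq137Torus.T`.

## The print (verbatim, p. 263 [PDF 7]; [I] p. 326 [PDF 28])

p. 263: *"|(G_{k,loc}(u)f − G_k(Ω,u)f)(x)| ≦ e^{−cr(e_k)} e^{−c dist(suppt f, x)}‖f‖_∞, (2.31) for dist(x, Ω^c) ≧ O(r(e_k)). [Each G_k(□_α, u) is
close to G_k(Ω, u) for the relevant x₁, x₂, therefore the convex combination and G_{k,loc} are close also.] We assume that u is smooth in the □_α's
entering the sum in (2.27); for (2.31) we assume smoothness throughout the subset Ω ⊂ T_η. … Hence |Δ_{k,loc}(u; x₁, x₂) − Δ_k(Ω,u; x₁, x₂)| ≦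
e^{−cr(e_k)} e^{−c|x₁−x₂|} for dist({x₁, x₂}, Ω^c) > O(r(e_k)), (2.35)"*.  [I] p. 326: *"The propagators arising from Δ_k(u_k), under the restriction
(7.3.1) on the gauge field, also satisfy the regularity and decay estimates of [7]. In order to remain within the framework of this reference, we
remark that by change of gauge u_k can be transformed in a local region Λ into a configuration of the form exp[ie_kηA], where A is smooth and small."*

## What is proved (0 `sorry`; theorems only — no definition, no `Prop`-valued fact)

* §1 **`inputs_smallPlaquette_region`** — the three inputs of the row-restricted chain for a region: (H1.10) for `G_k(Ω,u)` at every row, (H1.10″)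
  for every `G_k(□_α,u)`, (H1.12″) for every `G_k(□_α,u) − G_k(Ω,u)` at the `10L^k`-deep rows of `□_α`, at one set of constants, for every
  `k`-block union `Ω ⊇ Ω₀` (p34's `decay110_smallPlaquette_region_uniform` + p27's cube member + p30's `close112_smallField_hC` with this `Ω`),
  threshold `(L^{2k}θ)² ≤ 1/500` (gen 22's `smallness_of_threshold`).
* §2 **`opClose231_smallPlaquette_region_cwt`**, **`close231_smallPlaquette_region_kernel_cwt`** — (2.31) operator and kernel forms with `G_k(Ω,u)`
  for every `k`-block union `Ω ⊇ Ω₀`, at every fine row of `Ω₀` of chart depth `≥ R₀ + R` (`R > 10L^k`), same brackets as the `Ω = T_η` members.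
* §3 **`close235_smallPlaquette_region_cwt`** — (2.35) with `Δ_k(Ω,u)` for every `k`-block union `Ω ⊇ Ω₀`, for `k`-sites whose blocks lie in
  `Ω₀` at chart depth `≥ R₀ + R`.
* §4 (v1.1, append-only) **`opClose231_smallPlaquette_region_cwt_nonvacuous`** — the hypotheses of §2's operator member are JOINTLY
  SATISFIABLE WITH A PROPER REGION: on a torus `(ℤ/2·3^{m+1})²`, `k = 1`, flat `u`, `Ω = Ω₀ = [0, 66)² ⊊ T`, `s_g = 1`, `W = 33`, `R = 31`, `R₀ = 1`,
  `R₁ = 0`, row `x ≡ (32, 32)`: every displayed hypothesis holds and the bound follows (so (i′) is not only about `Ω = T_η`).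
((2.30), (2.36), (2.38), (2.40), (2.41) do not involve `Ω`: gen 22's `BIJ88DeltaLocSmallPlaquetteTorusCwt` / `…CwtGauge` members stand.)

HONEST SCOPE / DIVERGENCE.  (i′) `Ω` = any union of `k`-blocks CONTAINING THE REFERENCE BOX `Ω₀` of the localization data (print: `Ω ⊂ T_η` where
`u` is smooth, rows at `dist(x, Ω^c) ≧ O(r(e_k))`; here the cubes are sub-boxes of `Ω₀`, so `Ω ⊇ Ω₀` puts every `□_α` inside `Ω`, and the depth
is the chart depth `≥ R₀ + R` inside `Ω₀`).  (ii)–(ix) of gen 22's `BIJ88DeltaLocSmallPlaquetteTorusCwt` otherwise verbatim (global (7.3.1)-type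
smallness `‖u(∂p) − 1‖ ≤ θ` on `T^{(0)}` with `(L^{2k}θ)² ≤ 1/500` — print: smoothness on `Ω` only; `2 ≤ d′ ≤ 3`, `L` odd `≥ 3`, `k ≤ K`,
`2(L^k−1)+4 < |T^{(0)}|`; p29's torus cubes, `X_α` = `10L^k`-deep rows, `R > 10L^k`; `δ₀, c₀` existential from `(d, ℓ, a)`; value members).
Imports: gen 22 `BIJ88DeltaLocSmallPlaquetteTorusCwt`, p34 `BIJ88NeumannPropagatorSmallFieldRegionSup`.
Literature + Mathlib only.  Unit `lit-balaban-p31` (literature-prover-lit-balaban-p31-g22-0), 2026-08-23.  NOT summit progress.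
-/

open scoped BigOperators Matrix ComplexConjugate
open Finset Matrix

namespace Literature.MathematicalPhysics.QuantumFieldTheory.BalabanImbrieJaffe1984to88.BIJ88DeltaLocSmallPlaquetteRegionCwt

open Literature.MathematicalPhysics.QuantumFieldTheory.Balaban1983to89
open BIJ88Sect3Statements (U1 toC starB norm_toC)
open BIJ85BlockAveragesTorus BIJ85BlockAveragesTorusK
open BIJ88NeumannPropagator227Torus (gBox)
open BIJ88DeltaLoc234Torus (gLocT deltaLocT deltaRegion)
open BIJ88NeumannPropagatorFlatDecayCube (cubeT boxCoord isBlockUnion_cubeT)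
open BIJ88Cutoffs21 (cutoff)
open BIJ88LocWeights227Torus
open BIJ88DeltaLocClose235General (opClose231_gen close231_kernel_gen close235_gen)
open BIJ88Close231RegularTorusCwt (deepRows mem_deepRows)
open BIJ85AbelianStokes (plaqC plaqC_eq_toC_plaqHol)
open BIJ88NeumannNoZeroModesTorus (IsBlockUnion)
open GaugeField (gaugeAct)
open BIJ88NeumannPropagatorSmallFieldClose (close112_smallField_hC)
open BIJ88NeumannPropagatorSmallFieldSupDecay (decay110_smallPlaquette_cube_uniform)
open BIJ88NeumannPropagatorSmallFieldRegionSup (decay110_smallPlaquette_region_uniform)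
open BIJ88DeltaLocSmallPlaquetteTorusCwt (smallness_of_threshold rowHyp_ii_deep rows_of_deep)

noncomputable section

variable {P : Params}


/-! ## §1 The three inputs of the row-restricted chain for a region `Ω ⊇ Ω₀`, at one set of constants -/

section Inputs

variable {d : ℕ}

/-- kernel: `e^{−δ'E} ≤ e^{−δE}` for `δ ≤ δ'`, `E ≥ 0`. [folklore] -/
private theorem exp_le_exp_of_rate {δ δ' E : ℝ} (hδ : δ ≤ δ') (hE : 0 ≤ E) : Real.exp (-(δ' * E)) ≤ Real.exp (-(δ * E)) :=
  Real.exp_le_exp.2 (neg_le_neg (mul_le_mul_of_nonneg_right hδ hE))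

/-- **THE THREE INPUTS OF THE ROW-RESTRICTED CHAIN AT A SMALL-PLAQUETTE BACKGROUND FOR A REGION `Ω ⊇ Ω₀` (ANY `k`-BLOCK UNION CONTAINING THE
REFERENCE BOX), AT ONE SET OF CONSTANTS, FOR THE TORUS CUBES OF RECORD** ([I] p. 326: *"The propagators arising from Δ_k(u_k), under the restriction (7.3.1) on the gauge field, also satisfy the
regularity and decay estimates of [7]"*).  For `2 ≤ d′ = d + 1 ≤ 3`, `L = ℓ + 1` odd, `a > 0`: there are `δ₀, c₀ > 0` (depending on `(d, ℓ, a)`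
only) such that on every torus of the series, at every level `1 ≤ k ≤ K` with `2(L^k − 1) + 4 < |T^{(0)}|`, for every `U(1)` field `u` with
`‖u(∂p) − 1‖ ≤ θ`, `0 ≤ θ`, `(L^{2k}θ)² ≤ 1/500`, every reference no-wrap box `Ω₀ = c·L^k + Π_i[0, L^kM₀_i)` (`M₀_i ≥ 1`, shorter than the torus)
and every spacing/half-width `(s, W)`, every `k`-block union `Ω ⊇ Ω₀`, with `G_k(X,u) = gBox (α_kL^{kd′}) ε⁻¹ u k X`:  (H1.10) for `X = Ω` at EVERY row (§1's
`decay110_smallPlaquette_region_uniform`); (H1.10″) for every torus cube `□_α = cubeFam … α` at its `10L^k`-deep rows (p27's `decay110_smallPlaquette_cube_uniform`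
through p29's `cubeFam_fits`, valid at every row); (H1.12″) for every `□_α ⊆ Ω` at its `10L^k`-deep rows, depths to `T ∖ □_α` (p30's
`close112_smallField_hC` fed with the first two) — at the common constants `c₀ = max`, `δ₀ = min`.
[cite: BalabanImbrieJaffe1985, p.326 «also satisfy the regularity and decay estimates of [7]»]
[cite: Balaban1983RegularityDecay, Theorem p.573 (1.10), (1.11)–(1.12)] -/
theorem inputs_smallPlaquette_region (d ℓ : ℕ) (hd1 : 1 ≤ d) (hd3 : d + 1 ≤ 3) (hℓ : 1 ≤ ℓ) (hodd : Odd (ℓ + 1)) {a : ℝ} (ha : 0 < a) :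
    ∃ δ₀ c₀ : ℝ, 0 < δ₀ ∧ 0 < c₀ ∧ ∀ (P : Params) (hPd : P.d = d + 1), P.L = ℓ + 1 →
      ∀ {k : ℕ}, 1 ≤ k → k ≤ P.K → 2 * (P.L ^ k - 1) + 4 < P.sitesPerDir 0 →
      ∀ (U : GaugeField P 0 U1) {θ : ℝ}, 0 ≤ θ → (∀ (y : Balaban1983to89.Site P 0) (μ ν : Fin P.d), ‖plaqC U y μ ν - 1‖ ≤ θ) →
        (((P.L : ℝ) ^ k) ^ 2 * θ) ^ 2 ≤ 1 / 500 →
      ∀ {c M0 : Fin (d + 1) → ℕ}, (∀ i, 1 ≤ M0 i) → (∀ i, c i * P.L ^ k + P.L ^ k * M0 i ≤ P.sitesPerDir 0) →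
        (∀ i, P.L ^ k * M0 i < P.sitesPerDir 0) → ∀ (s W : ℕ) (Ω : Finset (Balaban1983to89.Site P 0)), IsBlockUnion k Ω →
        (cubeT hPd (P.L ^ k) c fun i => P.L ^ k * M0 i) ⊆ Ω →
      (∀ x ∈ (univ : Finset (Balaban1983to89.Site P 0)), ∀ (f : Balaban1983to89.Site P 0 → ℂ) (F Ds : ℝ), (∀ y, ‖f y‖ ≤ F) → 0 ≤ Ds →
          (∀ y, f y ≠ 0 → Ds ≤ B5Ineq137Torus.T P 0 x y) →
          ‖(gBox (B1RG242Torus.α P a k * (P.L : ℝ) ^ (k * P.d)) P.eps⁻¹ U k Ω *ᵥ f) x‖ ≤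
            P.spacing k ^ 2 * (c₀ * Real.exp (-(δ₀ * (((P.L : ℝ) ^ k)⁻¹ * Ds))) * F)) ∧
      (∀ (α : ↥(labels (P.L ^ k) M0 s)), ∀ x ∈ deepRows (10 * (P.L : ℝ) ^ k) (cubeFam hPd (P.L ^ k) c M0 s W α),
        ∀ (f : Balaban1983to89.Site P 0 → ℂ) (F Ds : ℝ), (∀ y, ‖f y‖ ≤ F) → 0 ≤ Ds → (∀ y, f y ≠ 0 → Ds ≤ B5Ineq137Torus.T P 0 x y) →
          ‖(gBox (B1RG242Torus.α P a k * (P.L : ℝ) ^ (k * P.d)) P.eps⁻¹ U k (cubeFam hPd (P.L ^ k) c M0 s W α) *ᵥ f) x‖ ≤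
            P.spacing k ^ 2 * (c₀ * Real.exp (-(δ₀ * (((P.L : ℝ) ^ k)⁻¹ * Ds))) * F)) ∧
      (∀ (α : ↥(labels (P.L ^ k) M0 s)), ∀ x ∈ deepRows (10 * (P.L : ℝ) ^ k) (cubeFam hPd (P.L ^ k) c M0 s W α),
        ∀ (f : Balaban1983to89.Site P 0 → ℂ) (F Ds Db Df : ℝ), (∀ y, ‖f y‖ ≤ F) → (∀ y, y ∉ cubeFam hPd (P.L ^ k) c M0 s W α → f y = 0) →
          0 ≤ Ds → (∀ y, f y ≠ 0 → Ds ≤ B5Ineq137Torus.T P 0 x y) → 0 ≤ Db →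
          (∀ w, w ∉ cubeFam hPd (P.L ^ k) c M0 s W α → Db ≤ B5Ineq137Torus.T P 0 x w) → 0 ≤ Df →
          (∀ y, f y ≠ 0 → ∀ w, w ∉ cubeFam hPd (P.L ^ k) c M0 s W α → Df ≤ B5Ineq137Torus.T P 0 y w) →
          ‖(gBox (B1RG242Torus.α P a k * (P.L : ℝ) ^ (k * P.d)) P.eps⁻¹ U k (cubeFam hPd (P.L ^ k) c M0 s W α) *ᵥ f) x -
              (gBox (B1RG242Torus.α P a k * (P.L : ℝ) ^ (k * P.d)) P.eps⁻¹ U k Ω *ᵥ f) x‖ ≤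
            P.spacing k ^ 2 * (c₀ * Real.exp (-(δ₀ * (((P.L : ℝ) ^ k)⁻¹ * Ds))) *
              Real.exp (-(δ₀ * (((P.L : ℝ) ^ k)⁻¹ * (Db + Df)))) * F)) := by
  obtain ⟨δa, ca, hδa, hca, HA⟩ := decay110_smallPlaquette_region_uniform d ℓ hd3 hℓ ha
  obtain ⟨δb, cb, hδb, hcb, HB⟩ := decay110_smallPlaquette_cube_uniform d ℓ hd3 hℓ ha
  have hcab : 0 ≤ max ca cb := hca.le.trans (le_max_left _ _)
  have hδab : 0 < min δa δb := lt_min hδa hδb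
  obtain ⟨c₁, δ₁, hc₁, hδ₁, HC⟩ := close112_smallField_hC (d + 1) (ℓ + 1) (by omega) hd3 ⟨hodd, by omega⟩ ha hcab hδab
  refine ⟨min (min δa δb) δ₁, max (max ca cb) c₁, lt_min hδab hδ₁, lt_max_of_lt_left (lt_max_of_lt_left hca), ?_⟩
  intro P hPd hPL k hk1 hkK hbig U θ hθ0 hθ hτ c M0 hM0 hfit0 hN0 s W Ω hΩ hΩ₀
  have hkm : k ≤ P.m + P.K := hkK.trans (Nat.le_add_left _ _)
  have hk0 : 0 + k ≤ P.m + P.K := by omega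
  have hLr : (1 : ℝ) ≤ (P.L : ℝ) ^ k := one_le_pow₀ (B1RG242Torus.one_lt_cast_L P).le
  have hPk : (0 : ℝ) < (P.L : ℝ) ^ k := pow_pos P.cast_L_pos k
  have hdr : (P.d : ℝ) = (d : ℝ) + 1 := by rw [hPd]; push_cast; ring
  have hd1r : (1 : ℝ) ≤ P.d := by rw [hdr]; linarith [(Nat.cast_nonneg d : (0 : ℝ) ≤ d)]
  have hd3r : (P.d : ℝ) ≤ 3 := by rw [hPd]; exact_mod_cast hd3
  obtain ⟨hsm1, hsm2⟩ := smallness_of_threshold hd1r hd3r hLr hθ0 hτ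
  have hsk2 : 0 ≤ P.spacing k ^ 2 := sq_nonneg _
  -- (H1.10) for every torus cube at every row (p27's cube member under (7.3.1), via p29's `cubeFam_fits`), at `(cb, δb)`
  have hplaq : ∀ p : Balaban1983to89.Plaq P 0, ‖toC (GaugeField.plaqHol U p) - 1‖ ≤ θ := by
    rintro ⟨y, μ, ν, hμν⟩
    rw [← plaqC_eq_toC_plaqHol U y hμν]; exact hθ y μ ν
  have hT : ((P.d - 1 : ℕ) : ℝ) * ((P.L : ℝ) ^ k - 1) * θ ≤ ((P.d : ℝ) - 1) * ((P.L : ℝ) ^ k - 1) * θ := by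
    have e : ((P.d - 1 : ℕ) : ℝ) = (P.d : ℝ) - 1 := by
      rw [Nat.cast_sub P.hd, Nat.cast_one]
    rw [e]
  -- (H1.10) for the region at every row (p34's `decay110_smallPlaquette_region_uniform`), at `(ca, δa)`
  have IA : ∀ (x : Balaban1983to89.Site P 0) (f : Balaban1983to89.Site P 0 → ℂ) (F Ds : ℝ), (∀ y, ‖f y‖ ≤ F) →
      (∀ y, f y ≠ 0 → Ds ≤ B5Ineq137Torus.T P 0 x y) →
      ‖(gBox (B1RG242Torus.α P a k * (P.L : ℝ) ^ (k * P.d)) P.eps⁻¹ U k Ω *ᵥ f) x‖ ≤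
        P.spacing k ^ 2 * (ca * Real.exp (-(δa * (((P.L : ℝ) ^ k)⁻¹ * Ds))) * F) :=
    fun x f F Ds hF hsupp => HA P hPd hPL k hk1 hkm hbig U θ hθ0 hplaq _ hT hsm2 Ω hΩ x f F Ds hF hsupp
  have IB : ∀ (α : ↥(labels (P.L ^ k) M0 s)) (x : Balaban1983to89.Site P 0) (f : Balaban1983to89.Site P 0 → ℂ) (F Ds : ℝ),
      (∀ y, ‖f y‖ ≤ F) → (∀ y, f y ≠ 0 → Ds ≤ B5Ineq137Torus.T P 0 x y) →
      ‖(gBox (B1RG242Torus.α P a k * (P.L : ℝ) ^ (k * P.d)) P.eps⁻¹ U k (cubeFam hPd (P.L ^ k) c M0 s W α) *ᵥ f) x‖ ≤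
        P.spacing k ^ 2 * (cb * Real.exp (-(δb * (((P.L : ℝ) ^ k)⁻¹ * Ds))) * F) := by
    intro α x f F Ds hF hsupp
    obtain ⟨c', M, hM, hfit', hN', hα⟩ := cubeFam_fits (hPd := hPd) (s := s) (W := W) hM0 hfit0 hN0 α
    rw [hα]
    exact HB P hPd hPL k hk1 hkm hbig U θ hθ0 hplaq _ hT hsm2 c' M hM hfit' hN' x f F Ds hF hsupp
  -- the common constants
  have hδa' : min (min δa δb) δ₁ ≤ δa := (min_le_left _ _).trans (min_le_left _ _)
  have hδb' : min (min δa δb) δ₁ ≤ δb := (min_le_left _ _).trans (min_le_right _ _)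
  have hδ1' : min (min δa δb) δ₁ ≤ δ₁ := min_le_right _ _
  have hca' : ca ≤ max (max ca cb) c₁ := (le_max_left _ _).trans (le_max_left _ _)
  have hcb' : cb ≤ max (max ca cb) c₁ := (le_max_right _ _).trans (le_max_left _ _)
  have hc1' : c₁ ≤ max (max ca cb) c₁ := le_max_right _ _
  have hcab_a : ca ≤ max ca cb := le_max_left _ _
  have hcab_b : cb ≤ max ca cb := le_max_right _ _
  have hδab_a : min δa δb ≤ δa := min_le_left _ _
  have hδab_b : min δa δb ≤ δb := min_le_right _ _
  -- the cubes are unions of `k`-blocks; the deep rows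
  have hcubeBU : ∀ α : ↥(labels (P.L ^ k) M0 s), IsBlockUnion k (cubeFam hPd (P.L ^ k) c M0 s W α) := fun α => by
    obtain ⟨c', M, hM, hfit', -, e⟩ := cubeFam_fits (hPd := hPd) (s := s) (W := W) hM0 hfit0 hN0 α
    rw [e]; exact isBlockUnion_cubeT hPd hkm rfl hfit'
  have hXr : ∀ α : ↥(labels (P.L ^ k) M0 s), ∀ x ∈ deepRows (10 * (P.L : ℝ) ^ k) (cubeFam hPd (P.L ^ k) c M0 s W α),
      x ∈ cubeFam hPd (P.L ^ k) c M0 s W α ∧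
        ∀ w, w ∉ cubeFam hPd (P.L ^ k) c M0 s W α → 10 * (P.L : ℝ) ^ k ≤ B5Ineq137Torus.T P 0 x w := by
    intro α x hx
    have h := mem_deepRows.1 hx
    refine ⟨h x (by rw [B5Ineq137Torus.T_self P 0 x]; positivity), fun w hw => ?_⟩
    by_contra hlt
    exact hw (h w (le_of_lt (lt_of_not_ge hlt)))
  -- the two (H1.10″) members at the intermediate constants `(max ca cb, min δa δb)` fed to p30's (H1.12″) member
  have IB' : ∀ (α : ↥(labels (P.L ^ k) M0 s)), ∀ x ∈ cubeFam hPd (P.L ^ k) c M0 s W α, ∀ (f : Balaban1983to89.Site P 0 → ℂ)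
      (F Ds : ℝ), (∀ y, ‖f y‖ ≤ F) → 0 ≤ Ds → (∀ y, f y ≠ 0 → Ds ≤ B5Ineq137Torus.T P 0 x y) →
      ‖(gBox (B1RG242Torus.α P a k * (P.L : ℝ) ^ (k * P.d)) P.eps⁻¹ U k (cubeFam hPd (P.L ^ k) c M0 s W α) *ᵥ f) x‖ ≤
        P.spacing k ^ 2 * (max ca cb * Real.exp (-(min δa δb * (((P.L : ℝ) ^ k)⁻¹ * Ds))) * F) := by
    intro α x _ f F Ds hF hDs hsupp
    have hF0 : 0 ≤ F := (norm_nonneg _).trans (hF x)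
    refine (IB α x f F Ds hF hsupp).trans (mul_le_mul_of_nonneg_left ?_ hsk2)
    exact mul_le_mul_of_nonneg_right (mul_le_mul hcab_b (exp_le_exp_of_rate hδab_b (mul_nonneg (inv_pos.2 hPk).le hDs))
      (Real.exp_pos _).le (hcb.le.trans hcab_b)) hF0
  have IA' : ∀ (α : ↥(labels (P.L ^ k) M0 s)), ∀ x ∈ cubeFam hPd (P.L ^ k) c M0 s W α, ∀ (f : Balaban1983to89.Site P 0 → ℂ)
      (F Ds : ℝ), (∀ y, ‖f y‖ ≤ F) → 0 ≤ Ds → (∀ y, f y ≠ 0 → Ds ≤ B5Ineq137Torus.T P 0 x y) →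
      ‖(gBox (B1RG242Torus.α P a k * (P.L : ℝ) ^ (k * P.d)) P.eps⁻¹ U k Ω *ᵥ f) x‖ ≤
        P.spacing k ^ 2 * (max ca cb * Real.exp (-(min δa δb * (((P.L : ℝ) ^ k)⁻¹ * Ds))) * F) := by
    intro α x _ f F Ds hF hDs hsupp
    have hF0 : 0 ≤ F := (norm_nonneg _).trans (hF x)
    refine (IA x f F Ds hF hsupp).trans (mul_le_mul_of_nonneg_left ?_ hsk2)
    exact mul_le_mul_of_nonneg_right (mul_le_mul hcab_a (exp_le_exp_of_rate hδab_a (mul_nonneg (inv_pos.2 hPk).le hDs))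
      (Real.exp_pos _).le (hca.le.trans hcab_a)) hF0
  refine ⟨?_, ?_, ?_⟩
  · -- (H1.10) for the region, every row
    intro x _ f F Ds hF hDs hsupp
    have hF0 : 0 ≤ F := (norm_nonneg _).trans (hF x)
    refine (IA x f F Ds hF hsupp).trans (mul_le_mul_of_nonneg_left ?_ hsk2)
    exact mul_le_mul_of_nonneg_right (mul_le_mul hca' (exp_le_exp_of_rate hδa' (mul_nonneg (inv_pos.2 hPk).le hDs))
      (Real.exp_pos _).le (hca.le.trans hca')) hF0
  · -- (H1.10″) for the torus cubes at their deep rows (in fact at every row)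
    intro α x _ f F Ds hF hDs hsupp
    have hF0 : 0 ≤ F := (norm_nonneg _).trans (hF x)
    refine (IB α x f F Ds hF hsupp).trans (mul_le_mul_of_nonneg_left ?_ hsk2)
    exact mul_le_mul_of_nonneg_right (mul_le_mul hcb' (exp_le_exp_of_rate hδb' (mul_nonneg (inv_pos.2 hPk).le hDs))
      (Real.exp_pos _).le (hcb.le.trans hcb')) hF0
  · -- (H1.12″) for the torus cubes against the region, at their `10L^k`-deep rows (p30)
    intro α x hx f F Ds Db Df hF hfB hDs hsupp hDb hsDb hDf hsDf
    have hF0 : 0 ≤ F := (norm_nonneg _).trans (hF x)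
    have hsub : ∀ α : ↥(labels (P.L ^ k) M0 s), cubeFam hPd (P.L ^ k) c M0 s W α ⊆ Ω := fun α =>
      (cubeOf_subset (hPd := hPd) (n := P.L ^ k) (c := c) (M0 := M0) (s := s) (W := W) α.1).trans hΩ₀
    have h := HC P hPd hPL k hk1 hkK U θ hθ hsm1 Ω (cubeFam hPd (P.L ^ k) c M0 s W)
      (fun α => deepRows (10 * (P.L : ℝ) ^ k) (cubeFam hPd (P.L ^ k) c M0 s W α)) hΩ hcubeBU
      hsub hXr IB' IA' α x hx f F Ds Db Df hF hfB hDs hsupp hDb hsDb hDf hsDf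
    refine h.trans (mul_le_mul_of_nonneg_left ?_ hsk2)
    refine mul_le_mul_of_nonneg_right ?_ hF0
    exact mul_le_mul (mul_le_mul hc1' (exp_le_exp_of_rate hδ1' (mul_nonneg (inv_pos.2 hPk).le hDs)) (Real.exp_pos _).le
      (hc₁.le.trans hc1')) (exp_le_exp_of_rate hδ1' (mul_nonneg (inv_pos.2 hPk).le (add_nonneg hDb hDf))) (Real.exp_pos _).le
      (mul_nonneg (hc₁.le.trans hc1') (Real.exp_pos _).le)

end Inputs

/-! ## §2 (2.31), operator and kernel forms, for a region `Ω ⊇ Ω₀` at a small-plaquette background -/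

section Members231

variable {d : ℕ}

/-- kernel: a deeper chart margin implies a shallower one. [folklore] -/
private theorem depth_mono (hPd : P.d = d + 1) {n : ℕ} {c M0 : Fin (d + 1) → ℕ} {D D' : ℝ} (hDD : D ≤ D')
    {x : Balaban1983to89.Site P 0}
    (hdeep : ∀ i, D' ≤ (boxCoord hPd n c x i : ℝ) ∧ (boxCoord hPd n c x i : ℝ) + D' ≤ (n * M0 i : ℕ) - 1) :
    ∀ i, D ≤ (boxCoord hPd n c x i : ℝ) ∧ (boxCoord hPd n c x i : ℝ) + D ≤ (n * M0 i : ℕ) - 1 :=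
  fun i => ⟨hDD.trans (hdeep i).1, by linarith [(hdeep i).2]⟩

/-- **(2.31), OPERATOR FORM, FOR A GENERAL REGION `Ω ⊇ Ω₀` AT A GENERAL SMALL-PLAQUETTE NON-FLAT BACKGROUND, FOR THE PRINTED TORUS DATA** (p. 263:
*"|(G_{k,loc}(u)f − G_k(Ω,u)f)(x)| ≦ e^{−cr(e_k)}e^{−c dist(suppt f,x)}‖f‖_∞ (2.31) for dist(x, Ω^c) ≧ O(r(e_k)) … for (2.31) we assume smoothness
throughout the subset Ω ⊂ T_η"*).  For `2 ≤ d′ = d + 1 ≤ 3`, `L = ℓ + 1` odd, `a > 0`: `∃ δ₀, c₀ > 0` (from `(d, ℓ, a)` only) such that on every torus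
of the series, at every level `1 ≤ k ≤ K` with `2(L^k − 1) + 4 < |T^{(0)}|`, for every `U(1)` field `u` with `‖u(∂p) − 1‖ ≤ θ`, `0 ≤ θ`,
`(L^{2k}θ)² ≤ 1/500`, every reference no-wrap box `Ω₀`, spacing `s_g ≥ 1`, half-width `W ≥ 2s_g/3 + R₀/2 + R`, radii `R > 10L^k`, `0 ≤ R₁ < R₀`,
EVERY union `Ω` of `k`-blocks with `Ω₀ ⊆ Ω`, every fine row `x ∈ Ω₀` of chart depth `≥ R₀ + R`, and every `f` with `‖f‖_∞ ≤ F` supported at sup-torus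
distance `≥ D ≥ 0` from `x`: `‖(G_{k,loc}(u)f − G_k(Ω,u)f)(x)‖ ≤ (L^kε)²·c₀·(m·e^{−2δ₀R/L^k} + e^{−(δ₀/2)R₁/L^k})·e^{−(δ₀/2)D/L^k}·F` — p31 v1.1's
`opClose231_gen` BY NAME with this `Ω`, `X₀ = T^{(0)}`, inputs §1. [cite: BalabanImbrieJaffe1988, (2.31) p.263] [cite: BalabanImbrieJaffe1985, (7.3.1) p.326] -/
theorem opClose231_smallPlaquette_region_cwt (d ℓ : ℕ) (hd1 : 1 ≤ d) (hd3 : d + 1 ≤ 3) (hℓ : 1 ≤ ℓ) (hodd : Odd (ℓ + 1)) {a : ℝ} (ha : 0 < a) :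
    ∃ δ₀ c₀ : ℝ, 0 < δ₀ ∧ 0 < c₀ ∧ ∀ (P : Params) (hPd : P.d = d + 1), P.L = ℓ + 1 →
      ∀ (k : ℕ), 1 ≤ k → k ≤ P.K → 2 * (P.L ^ k - 1) + 4 < P.sitesPerDir 0 →
      ∀ (U : GaugeField P 0 U1) (θ : ℝ), 0 ≤ θ → (∀ (y : Balaban1983to89.Site P 0) (μ ν : Fin P.d), ‖plaqC U y μ ν - 1‖ ≤ θ) →
        (((P.L : ℝ) ^ k) ^ 2 * θ) ^ 2 ≤ 1 / 500 →
      ∀ (c M0 : Fin (d + 1) → ℕ), (∀ i, 1 ≤ M0 i) → (∀ i, c i * P.L ^ k + P.L ^ k * M0 i ≤ P.sitesPerDir 0) →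
        (∀ i, P.L ^ k * M0 i < P.sitesPerDir 0) →
      ∀ (sg W : ℕ), 1 ≤ sg → ∀ (R R₀ R₁ : ℝ), 10 * (P.L : ℝ) ^ k < R → 0 ≤ R₁ → R₁ < R₀ →
        2 * (sg : ℝ) / 3 + R₀ / 2 + R ≤ W → (∀ i, ((P.L ^ k * M0 i : ℕ) : ℝ) + R ≤ P.sitesPerDir 0) →
      ∀ (Ω : Finset (Balaban1983to89.Site P 0)), IsBlockUnion k Ω → (cubeT hPd (P.L ^ k) c fun i => P.L ^ k * M0 i) ⊆ Ω →
      ∀ (x : Balaban1983to89.Site P 0), x ∈ (cubeT hPd (P.L ^ k) c fun i => P.L ^ k * M0 i) →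
        (∀ i, R₀ + R ≤ (boxCoord hPd (P.L ^ k) c x i : ℝ) ∧ (boxCoord hPd (P.L ^ k) c x i : ℝ) + (R₀ + R) ≤ (P.L ^ k * M0 i : ℕ) - 1) →
      ∀ (f : Balaban1983to89.Site P 0 → ℂ) (F D : ℝ), (∀ y, ‖f y‖ ≤ F) → 0 ≤ D → (∀ y, f y ≠ 0 → D ≤ B5Ineq137Torus.T P 0 x y) →
        ‖(gLocT (B1RG242Torus.α P a k * (P.L : ℝ) ^ (k * P.d)) P.eps⁻¹ U k
              (cubeFam hPd (P.L ^ k) c M0 sg W) (lamFam hPd (P.L ^ k) c M0 sg) (cutoff R₁ R₀ (B5Ineq137Torus.T P 0)) *ᵥ f) x -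
            (gBox (B1RG242Torus.α P a k * (P.L : ℝ) ^ (k * P.d)) P.eps⁻¹ U k Ω *ᵥ f) x‖ ≤
          P.spacing k ^ 2 * (c₀ * (((⌊(((P.L : ℝ) ^ k) - 1 + R₀) / sg⌋₊ : ℝ) + 3) ^ (d + 1) *
              Real.exp (-(δ₀ * (((P.L : ℝ) ^ k)⁻¹ * (2 * R)))) +
                Real.exp (-(δ₀ / 2 * (((P.L : ℝ) ^ k)⁻¹ * R₁)))) *
            Real.exp (-(δ₀ / 2 * (((P.L : ℝ) ^ k)⁻¹ * D))) * F) := by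
  obtain ⟨δ₀, c₀, hδ₀, hc₀, I⟩ := inputs_smallPlaquette_region d ℓ hd1 hd3 hℓ hodd ha
  refine ⟨δ₀, c₀, hδ₀, hc₀, ?_⟩
  intro P hPd hPL k hk1 hkK hbig U θ hθ0 hθ hτ c M0 hM0 hfit0 hN0 sg W hsg R R₀ R₁ hRm hR₁ hR10 hW hgap Ω hΩ hΩ₀ x hx hdeep f F D hF hD hsupp
  obtain ⟨I1, -, I3⟩ := I P hPd hPL hk1 hkK hbig U hθ0 hθ hτ hM0 hfit0 hN0 sg W Ω hΩ hΩ₀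
  have hkm : k ≤ P.m + P.K := hkK.trans (Nat.le_add_left _ _)
  have hk : 0 + k ≤ P.m + P.K := by omega
  have hn : 1 ≤ P.L ^ k := Nat.one_le_pow _ _ P.L_pos
  have hPk : (0 : ℝ) < (P.L : ℝ) ^ k := pow_pos P.cast_L_pos k
  have hR : 0 ≤ R := le_trans (by positivity) hRm.le
  have hR₀ : 0 ≤ R₀ := hR₁.trans hR10.le
  have hζ0 := cutoff_eq_zero_of_le (P := P) hR10
  have hF0 : 0 ≤ F := (norm_nonneg _).trans (hF x)
  have hdeep₀ := depth_mono hPd (show R₀ ≤ R₀ + R by linarith) hdeep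
  set S : Finset ↥(labels (P.L ^ k) M0 sg) :=
    (activeLabels hPd (P.L ^ k) c sg R₀ (blkIter k x)).subtype fun α => α ∈ labels (P.L ^ k) M0 sg with hSdef
  have hS : ∀ (α : ↥(labels (P.L ^ k) M0 sg)) (y : Balaban1983to89.Site P 0),
      cutoff R₁ R₀ (B5Ineq137Torus.T P 0) x y * lamFam hPd (P.L ^ k) c M0 sg α x y ≠ 0 → f y ≠ 0 → α ∈ S := by
    intro α y hne _
    rw [hSdef, Finset.mem_subtype]
    exact mem_activeLabels_of_ne_zero_of_deep hk hsg hfit0 hζ0 (mem_blockK.2 rfl) hdeep₀ hne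
  have hB := opClose231_gen (B1RG242Torus.α P a k * (P.L : ℝ) ^ (k * P.d)) P.eps⁻¹ U Ω univ
    (cubeFam hPd (P.L ^ k) c M0 sg W) (fun α => deepRows (10 * (P.L : ℝ) ^ k) (cubeFam hPd (P.L ^ k) c M0 sg W α))
    (lam := lamFam hPd (P.L ^ k) c M0 sg) (ζ'' := cutoff R₁ R₀ (B5Ineq137Torus.T P 0))
    (sum_abs_lamT_le_one hfit0) (cutoff_mem_unitInterval R₁ R₀) hδ₀.le hc₀.le I1 I3
    x (mem_univ x) hR (rowHyp_i hPd hfit0 hζ0 hx hdeep₀)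
    (rowHyp_ii_deep hPd hn hsg hfit0 hR hR₀ hRm hgap hW hζ0 hx hdeep) (rowHyp_iii hR10 x) f hF hD hsupp S hS
  refine hB.trans ?_
  have hcard : (S.card : ℝ) ≤ (⌊(((P.L : ℝ) ^ k) - 1 + R₀) / sg⌋₊ + 3) ^ (d + 1) := by
    have h1 := card_subtype_activeLabels_le (hPd := hPd) (c := c) (M0 := M0) hn hsg hR₀ (blkIter k x)
    have e1 : (((P.L ^ k : ℕ) : ℕ) : ℝ) = (P.L : ℝ) ^ k := by push_cast; rfl
    rw [hSdef]
    rw [e1] at h1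
    exact h1
  have hE1 := (Real.exp_pos (-(δ₀ * (((P.L : ℝ) ^ k)⁻¹ * (2 * R))))).le
  have hE2 := (Real.exp_pos (-(δ₀ / 2 * (((P.L : ℝ) ^ k)⁻¹ * D)))).le
  refine mul_le_mul_of_nonneg_left ?_ (sq_nonneg _)
  refine mul_le_mul_of_nonneg_right (mul_le_mul_of_nonneg_right (mul_le_mul_of_nonneg_left ?_ hc₀.le) hE2) hF0
  exact add_le_add (mul_le_mul_of_nonneg_right hcard hE1) le_rfl

/-- **(2.31), KERNEL FORM, FOR A GENERAL REGION `Ω ⊇ Ω₀` AT A GENERAL SMALL-PLAQUETTE BACKGROUND, FOR THE PRINTED TORUS DATA**: with the data and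
hypotheses of `opClose231_smallPlaquette_region_cwt`, for every fine row `x ∈ Ω₀` of chart depth `≥ R₀ + R` and EVERY `y ∈ T^{(0)}`:
`‖G_{k,loc}(u; x, y) − G_k(Ω, u; x, y)‖ ≤ (L^kε)²·c₀·(e^{−2δ₀R/L^k} + e^{−(δ₀/2)R₁/L^k})·e^{−(δ₀/2)|x−y|_T/L^k}` — p31 v1.1's `close231_kernel_gen` BY NAME.
[cite: BalabanImbrieJaffe1988, (2.31) p.263] -/
theorem close231_smallPlaquette_region_kernel_cwt (d ℓ : ℕ) (hd1 : 1 ≤ d) (hd3 : d + 1 ≤ 3) (hℓ : 1 ≤ ℓ) (hodd : Odd (ℓ + 1)) {a : ℝ}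
    (ha : 0 < a) :
    ∃ δ₀ c₀ : ℝ, 0 < δ₀ ∧ 0 < c₀ ∧ ∀ (P : Params) (hPd : P.d = d + 1), P.L = ℓ + 1 →
      ∀ (k : ℕ), 1 ≤ k → k ≤ P.K → 2 * (P.L ^ k - 1) + 4 < P.sitesPerDir 0 →
      ∀ (U : GaugeField P 0 U1) (θ : ℝ), 0 ≤ θ → (∀ (y : Balaban1983to89.Site P 0) (μ ν : Fin P.d), ‖plaqC U y μ ν - 1‖ ≤ θ) →
        (((P.L : ℝ) ^ k) ^ 2 * θ) ^ 2 ≤ 1 / 500 →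
      ∀ (c M0 : Fin (d + 1) → ℕ), (∀ i, 1 ≤ M0 i) → (∀ i, c i * P.L ^ k + P.L ^ k * M0 i ≤ P.sitesPerDir 0) →
        (∀ i, P.L ^ k * M0 i < P.sitesPerDir 0) →
      ∀ (sg W : ℕ), 1 ≤ sg → ∀ (R R₀ R₁ : ℝ), 10 * (P.L : ℝ) ^ k < R → 0 ≤ R₁ → R₁ < R₀ →
        2 * (sg : ℝ) / 3 + R₀ / 2 + R ≤ W → (∀ i, ((P.L ^ k * M0 i : ℕ) : ℝ) + R ≤ P.sitesPerDir 0) →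
      ∀ (Ω : Finset (Balaban1983to89.Site P 0)), IsBlockUnion k Ω → (cubeT hPd (P.L ^ k) c fun i => P.L ^ k * M0 i) ⊆ Ω →
      ∀ (x : Balaban1983to89.Site P 0), x ∈ (cubeT hPd (P.L ^ k) c fun i => P.L ^ k * M0 i) →
        (∀ i, R₀ + R ≤ (boxCoord hPd (P.L ^ k) c x i : ℝ) ∧ (boxCoord hPd (P.L ^ k) c x i : ℝ) + (R₀ + R) ≤ (P.L ^ k * M0 i : ℕ) - 1) →
      ∀ y : Balaban1983to89.Site P 0,
        ‖gLocT (B1RG242Torus.α P a k * (P.L : ℝ) ^ (k * P.d)) P.eps⁻¹ U k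
              (cubeFam hPd (P.L ^ k) c M0 sg W) (lamFam hPd (P.L ^ k) c M0 sg) (cutoff R₁ R₀ (B5Ineq137Torus.T P 0)) x y -
            gBox (B1RG242Torus.α P a k * (P.L : ℝ) ^ (k * P.d)) P.eps⁻¹ U k Ω x y‖ ≤
          P.spacing k ^ 2 * (c₀ * (Real.exp (-(δ₀ * (((P.L : ℝ) ^ k)⁻¹ * (2 * R)))) +
              Real.exp (-(δ₀ / 2 * (((P.L : ℝ) ^ k)⁻¹ * R₁)))) *
            Real.exp (-(δ₀ / 2 * (((P.L : ℝ) ^ k)⁻¹ * B5Ineq137Torus.T P 0 x y)))) := by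
  obtain ⟨δ₀, c₀, hδ₀, hc₀, I⟩ := inputs_smallPlaquette_region d ℓ hd1 hd3 hℓ hodd ha
  refine ⟨δ₀, c₀, hδ₀, hc₀, ?_⟩
  intro P hPd hPL k hk1 hkK hbig U θ hθ0 hθ hτ c M0 hM0 hfit0 hN0 sg W hsg R R₀ R₁ hRm hR₁ hR10 hW hgap Ω hΩ hΩ₀ x hx hdeep y
  obtain ⟨I1, -, I3⟩ := I P hPd hPL hk1 hkK hbig U hθ0 hθ hτ hM0 hfit0 hN0 sg W Ω hΩ hΩ₀
  have hkm : k ≤ P.m + P.K := hkK.trans (Nat.le_add_left _ _)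
  have hk : 0 + k ≤ P.m + P.K := by omega
  have hn : 1 ≤ P.L ^ k := Nat.one_le_pow _ _ P.L_pos
  have hPk : (0 : ℝ) < (P.L : ℝ) ^ k := pow_pos P.cast_L_pos k
  have hR : 0 ≤ R := le_trans (by positivity) hRm.le
  have hR₀ : 0 ≤ R₀ := hR₁.trans hR10.le
  have hζ0 := cutoff_eq_zero_of_le (P := P) hR10
  have hdeep₀ := depth_mono hPd (show R₀ ≤ R₀ + R by linarith) hdeep
  exact close231_kernel_gen (B1RG242Torus.α P a k * (P.L : ℝ) ^ (k * P.d)) P.eps⁻¹ U Ω univ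
    (cubeFam hPd (P.L ^ k) c M0 sg W) (fun α => deepRows (10 * (P.L : ℝ) ^ k) (cubeFam hPd (P.L ^ k) c M0 sg W α))
    (lam := lamFam hPd (P.L ^ k) c M0 sg) (ζ'' := cutoff R₁ R₀ (B5Ineq137Torus.T P 0))
    (sum_abs_lamT_le_one hfit0) (cutoff_mem_unitInterval R₁ R₀) hδ₀.le hc₀.le I1 I3
    x (mem_univ x) hR (rowHyp_i hPd hfit0 hζ0 hx hdeep₀)
    (rowHyp_ii_deep hPd hn hsg hfit0 hR hR₀ hRm hgap hW hζ0 hx hdeep) (rowHyp_iii hR10 x) y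

end Members231

/-! ## §3 (2.35) for a region `Ω ⊇ Ω₀` at a small-plaquette background -/

section Member235

variable {d : ℕ}

/-- **(2.35) FOR A GENERAL REGION `Ω ⊇ Ω₀` AT A GENERAL SMALL-PLAQUETTE NON-FLAT BACKGROUND, FOR THE PRINTED TORUS DATA** (p. 263: *"Hence
|Δ_{k,loc}(u;x₁,x₂) − Δ_k(Ω,u;x₁,x₂)| ≦ e^{−cr(e_k)}e^{−c|x₁−x₂|} for dist({x₁,x₂},Ω^c) > O(r(e_k)). (2.35)"*): with the data of
`opClose231_smallPlaquette_region_cwt`, for every union `Ω` of `k`-blocks with `Ω₀ ⊆ Ω`, every `k`-site `y₁` whose block lies in `Ω₀` with chart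
margin `R₀ + R` and every `y₂ ∈ T^{(k)}`:
`‖Δ_{k,loc}(u; y₁, y₂) − Δ_k(Ω,u; y₁, y₂)‖ ≤ A·a_k·c₀e^{δ₀/2}·(m·e^{−2δ₀R/L^k} + e^{−(δ₀/2)R₁/L^k})·e^{−(δ₀/2)|y₁−y₂|_{T^{(k)}}}` — p31 v1.1's `close235_gen` BY
NAME with this `Ω`, rows from gen 22's `rows_of_deep`. [cite: BalabanImbrieJaffe1988, (2.35) p.263] -/
theorem close235_smallPlaquette_region_cwt (d ℓ : ℕ) (hd1 : 1 ≤ d) (hd3 : d + 1 ≤ 3) (hℓ : 1 ≤ ℓ) (hodd : Odd (ℓ + 1)) {a : ℝ} (ha : 0 < a) :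
    ∃ δ₀ c₀ : ℝ, 0 < δ₀ ∧ 0 < c₀ ∧ ∀ (P : Params) (hPd : P.d = d + 1), P.L = ℓ + 1 →
      ∀ (k : ℕ), 1 ≤ k → k ≤ P.K → 2 * (P.L ^ k - 1) + 4 < P.sitesPerDir 0 →
      ∀ (U : GaugeField P 0 U1) (θ : ℝ), 0 ≤ θ → (∀ (y : Balaban1983to89.Site P 0) (μ ν : Fin P.d), ‖plaqC U y μ ν - 1‖ ≤ θ) →
        (((P.L : ℝ) ^ k) ^ 2 * θ) ^ 2 ≤ 1 / 500 →
      ∀ (c M0 : Fin (d + 1) → ℕ), (∀ i, 1 ≤ M0 i) → (∀ i, c i * P.L ^ k + P.L ^ k * M0 i ≤ P.sitesPerDir 0) →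
        (∀ i, P.L ^ k * M0 i < P.sitesPerDir 0) →
      ∀ (sg W : ℕ), 1 ≤ sg → ∀ (R R₀ R₁ : ℝ), 10 * (P.L : ℝ) ^ k < R → 0 ≤ R₁ → R₁ < R₀ →
        2 * (sg : ℝ) / 3 + R₀ / 2 + R ≤ W → (∀ i, ((P.L ^ k * M0 i : ℕ) : ℝ) + R ≤ P.sitesPerDir 0) →
      ∀ (Ω : Finset (Balaban1983to89.Site P 0)), IsBlockUnion k Ω → (cubeT hPd (P.L ^ k) c fun i => P.L ^ k * M0 i) ⊆ Ω →
      ∀ (y₁ y₂ : Balaban1983to89.Site P (0 + k)),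
        (∀ μ, (c (Fin.cast hPd μ) : ℝ) * P.L ^ k + (R₀ + R) ≤ (P.L : ℝ) ^ k * (y₁ μ).val ∧
          (P.L : ℝ) ^ k * (y₁ μ).val + P.L ^ k + (R₀ + R) ≤ (c (Fin.cast hPd μ) : ℝ) * P.L ^ k + (P.L : ℝ) ^ k * M0 (Fin.cast hPd μ)) →
        ‖deltaLocT (B1RG242Torus.α P a k * (P.L : ℝ) ^ (k * P.d)) P.eps⁻¹ U k
              (cubeFam hPd (P.L ^ k) c M0 sg W) (lamFam hPd (P.L ^ k) c M0 sg) (cutoff R₁ R₀ (B5Ineq137Torus.T P 0)) y₁ y₂ -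
            deltaRegion (B1RG242Torus.α P a k * (P.L : ℝ) ^ (k * P.d)) P.eps⁻¹ U k Ω y₁ y₂‖ ≤
          (B1RG242Torus.α P a k * (P.L : ℝ) ^ (k * P.d)) * (B1.aSeq a P.L k * (c₀ * Real.exp (δ₀ / 2)) *
            (((⌊(((P.L : ℝ) ^ k) - 1 + R₀) / sg⌋₊ : ℝ) + 3) ^ (d + 1) *
              Real.exp (-(δ₀ * (((P.L : ℝ) ^ k)⁻¹ * (2 * R)))) +
                Real.exp (-(δ₀ / 2 * (((P.L : ℝ) ^ k)⁻¹ * R₁)))) *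
              Real.exp (-(δ₀ / 2 * B5Ineq137Torus.T P (0 + k) y₁ y₂))) := by
  obtain ⟨δ₀, c₀, hδ₀, hc₀, I⟩ := inputs_smallPlaquette_region d ℓ hd1 hd3 hℓ hodd ha
  refine ⟨δ₀, c₀, hδ₀, hc₀, ?_⟩
  intro P hPd hPL k hk1 hkK hbig U θ hθ0 hθ hτ c M0 hM0 hfit0 hN0 sg W hsg R R₀ R₁ hRm hR₁ hR10 hW hgap Ω hΩ hΩ₀ y₁ y₂ hy₁
  obtain ⟨I1, -, I3⟩ := I P hPd hPL hk1 hkK hbig U hθ0 hθ hτ hM0 hfit0 hN0 sg W Ω hΩ hΩ₀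
  have hkm : k ≤ P.m + P.K := hkK.trans (Nat.le_add_left _ _)
  have hk : 0 + k ≤ P.m + P.K := by omega
  have hn : 1 ≤ P.L ^ k := Nat.one_le_pow _ _ P.L_pos
  have hPk : (0 : ℝ) < (P.L : ℝ) ^ k := pow_pos P.cast_L_pos k
  have hR : 0 ≤ R := le_trans (by positivity) hRm.le
  have hR₀ : 0 ≤ R₀ := hR₁.trans hR10.le
  have hζ0 := cutoff_eq_zero_of_le (P := P) hR10
  obtain ⟨hX₀, hcomp, hdeep, hcut, S, hSm, hS⟩ := rows_of_deep hPd hk hn hsg hfit0 hR hR₁ hR10 hRm hgap hW hy₁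
  have h := close235_gen hk1 hk ha P.eps⁻¹ U Ω univ (cubeFam hPd (P.L ^ k) c M0 sg W)
    (fun α => deepRows (10 * (P.L : ℝ) ^ k) (cubeFam hPd (P.L ^ k) c M0 sg W α))
    (lam := lamFam hPd (P.L ^ k) c M0 sg) (ζ'' := cutoff R₁ R₀ (B5Ineq137Torus.T P 0))
    (sum_abs_lamT_le_one hfit0) (cutoff_mem_unitInterval R₁ R₀) hδ₀.le hc₀.le I1 I3 hR y₁ y₂ hX₀ hcomp hdeep hcut S hS
  refine h.trans ?_
  have hak0 : 0 < B1.aSeq a P.L k := B1.aSeq_pos ha (B1RG242Torus.one_lt_cast_L P) hk1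
  have hα : 0 < B1RG242Torus.α P a k := mul_pos hak0 (inv_pos.mpr (pow_pos (P.spacing_pos k) 2))
  have hA0 : 0 ≤ B1RG242Torus.α P a k * (P.L : ℝ) ^ (k * P.d) := (mul_pos hα (pow_pos P.cast_L_pos _)).le
  have hSm' : (S.card : ℝ) ≤ (⌊(((P.L : ℝ) ^ k) - 1 + R₀) / sg⌋₊ + 3) ^ (d + 1) := by exact_mod_cast hSm
  have hE1 := (Real.exp_pos (-(δ₀ * (((P.L : ℝ) ^ k)⁻¹ * (2 * R))))).le
  refine mul_le_mul_of_nonneg_left ?_ hA0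
  refine mul_le_mul_of_nonneg_right (mul_le_mul_of_nonneg_left ?_ (by positivity)) (Real.exp_pos _).le
  exact add_le_add (mul_le_mul_of_nonneg_right hSm' hE1) le_rfl

end Member235

/-! ## §4 (v1.1) Non-vacuity with a proper region -/

section Instance

open BIJ85CovariantHiggsDictionary (expGauge)
open BIJ88Decay241RegularTorusCwt (norm_plaqC_expGauge_sub_one_le)
open BIJ88NeumannPropagatorFlatDecayCube (mem_cubeT_iff_val)

/-- **THE HYPOTHESES OF `opClose231_smallPlaquette_region_cwt` ARE JOINTLY SATISFIABLE WITH A PROPER REGION `Ω ⊊ T_η`** (so the region form of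
(2.31) at a small-plaquette field is not a statement about the empty set, nor only about `Ω = T_η`): for every `a > 0` the theorem yields `δ₀, c₀`
(here `d′ = 2`, `L = 3`), and — independently of them — on a torus `(ℤ/2·3^{m+1})²` (`3^m > 100`, `K = 1`), at level `k = 1`, for the flat
background `u = e^{i·0·εA} = 1` (`θ = 0`), the reference box `Ω₀ = [0, 66)²` (`c = 0`, `M₀ = 22`), spacing `s_g = 1`, half-width `W = 33`, radii
`R = 31 > 10L^k`, `R₁ = 0 < R₀ = 1`, THE REGION `Ω = Ω₀` ITSELF (a union of `k`-blocks, `|Ω| = 66² < |T|`) and the row `x ≡ (32, 32)` (chart depth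
`32 ≥ R₀ + R` in `Ω₀`), every displayed hypothesis holds; consequently `‖(G_{k,loc}(u)f − G_k(Ω,u)f)(x)‖ ≤ (L^kε)²·c₀·(25·e^{−2δ₀R/3} + 1)·‖f‖_∞`
for every `f` (`D = 0`). [cite: BalabanImbrieJaffe1988, (2.31) p.263] -/
theorem opClose231_smallPlaquette_region_cwt_nonvacuous {a : ℝ} (ha : 0 < a) :
    ∃ δ₀ c₀ : ℝ, 0 < δ₀ ∧ 0 < c₀ ∧
    ∃ (P : Params) (hPd : P.d = 1 + 1), P.L = 3 ∧
    ∃ (x : Balaban1983to89.Site P 0), (∀ μ, (x μ).val = 32) ∧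
      ∀ (f : Balaban1983to89.Site P 0 → ℂ) (F : ℝ), (∀ y, ‖f y‖ ≤ F) →
        ‖(gLocT (B1RG242Torus.α P a 1 * (P.L : ℝ) ^ (1 * P.d)) P.eps⁻¹ (expGauge P 0 fun _ => 0) 1
              (cubeFam hPd (P.L ^ 1) (fun _ => 0) (fun _ => 22) 1 33) (lamFam hPd (P.L ^ 1) (fun _ => 0) (fun _ => 22) 1)
              (cutoff 0 1 (B5Ineq137Torus.T P 0)) *ᵥ f) x -
            (gBox (B1RG242Torus.α P a 1 * (P.L : ℝ) ^ (1 * P.d)) P.eps⁻¹ (expGauge P 0 fun _ => 0) 1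
              (cubeT hPd (P.L ^ 1) (fun _ => 0) fun i => P.L ^ 1 * (fun _ => 22 : Fin (1 + 1) → ℕ) i) *ᵥ f) x‖ ≤
          P.spacing 1 ^ 2 * (c₀ * (((⌊(((P.L : ℝ) ^ 1) - 1 + 1) / (1 : ℕ)⌋₊ : ℝ) + 3) ^ (1 + 1) *
              Real.exp (-(δ₀ * (((P.L : ℝ) ^ 1)⁻¹ * (2 * 31)))) +
                Real.exp (-(δ₀ / 2 * (((P.L : ℝ) ^ 1)⁻¹ * 0)))) *
            Real.exp (-(δ₀ / 2 * (((P.L : ℝ) ^ 1)⁻¹ * 0))) * F) := by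
  obtain ⟨δ₀, c₀, hδ₀, hc₀, M⟩ := opClose231_smallPlaquette_region_cwt 1 2 le_rfl (by norm_num) (by norm_num) ⟨1, by norm_num⟩ ha
  refine ⟨δ₀, c₀, hδ₀, hc₀, ?_⟩
  -- the torus: any `m` with `3^m > 100`
  obtain ⟨m, hm⟩ := pow_unbounded_of_one_lt (100 : ℝ) (by norm_num : (1 : ℝ) < 3)
  have hX : 100 < 3 ^ m := by exact_mod_cast hm
  have hm1 : 1 ≤ m := by
    rcases Nat.eq_zero_or_pos m with h | h
    · subst h; norm_num at hX
    · exact h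
  set P : Params := ⟨2, 3, m, 1, by norm_num, ⟨⟨1, by norm_num⟩, by norm_num⟩⟩ with hPdef
  have hN0 : P.sitesPerDir 0 = 2 * (3 * 3 ^ m) := by
    show 2 * 3 ^ (m + 1 - 0) = _
    rw [Nat.sub_zero, pow_succ, mul_comm (3 ^ m) 3]
  have hPd : P.d = 1 + 1 := rfl
  -- the box data, kept opaque until the end
  obtain ⟨c0, hc0⟩ : ∃ c : Fin (1 + 1) → ℕ, c = fun _ => 0 := ⟨_, rfl⟩
  obtain ⟨M0, hM0⟩ : ∃ M : Fin (1 + 1) → ℕ, M = fun _ => 22 := ⟨_, rfl⟩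
  obtain ⟨v, hv⟩ : ∃ n : ℕ, n = 32 := ⟨_, rfl⟩
  have hvN : v < P.sitesPerDir 0 := by rw [hN0]; omega
  set x : Balaban1983to89.Site P 0 := fun _ => ((v : ℕ) : ZMod (P.sitesPerDir 0)) with hx
  have hxv : ∀ μ : Fin P.d, (x μ).val = v := by
    intro μ
    show ZMod.val ((v : ℕ) : ZMod (P.sitesPerDir 0)) = v
    rw [ZMod.val_natCast, Nat.mod_eq_of_lt hvN]
  have hfit0 : ∀ i : Fin (1 + 1), c0 i * P.L ^ 1 + P.L ^ 1 * M0 i ≤ P.sitesPerDir 0 := by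
    intro i; rw [hc0, hM0, hN0]; show 0 * 3 ^ 1 + 3 ^ 1 * 22 ≤ 2 * (3 * 3 ^ m); omega
  have hxmem : x ∈ cubeT hPd (P.L ^ 1) c0 (fun i => P.L ^ 1 * M0 i) := by
    rw [mem_cubeT_iff_val hPd hfit0]
    intro μ
    rw [hxv μ, hc0, hM0]
    show 0 * 3 ^ 1 ≤ v ∧ v < 0 * 3 ^ 1 + 3 ^ 1 * 22
    omega
  have hΩ : IsBlockUnion 1 (cubeT hPd (P.L ^ 1) c0 fun i => P.L ^ 1 * M0 i) :=
    isBlockUnion_cubeT hPd (by show 1 ≤ m + 1; omega) rfl hfit0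
  have hdeep : ∀ i : Fin (1 + 1), (1 : ℝ) + 31 ≤ (boxCoord hPd (P.L ^ 1) c0 x i : ℝ) ∧
      (boxCoord hPd (P.L ^ 1) c0 x i : ℝ) + (1 + 31) ≤ (P.L ^ 1 * M0 i : ℕ) - 1 := by
    intro i
    have hb : (boxCoord hPd (P.L ^ 1) c0 x i : ℝ) = v := by
      unfold boxCoord
      rw [hxv (Fin.cast hPd.symm i), hc0]
      beta_reduce
      push_cast
      ring
    rw [hb, hv, hM0]
    show (1 : ℝ) + 31 ≤ ((32 : ℕ) : ℝ) ∧ ((32 : ℕ) : ℝ) + (1 + 31) ≤ ((3 ^ 1 * 22 : ℕ) : ℝ) - 1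
    norm_num
  have hθ : ∀ (y : Balaban1983to89.Site P 0) (μ ν : Fin P.d), ‖plaqC (expGauge P 0 fun _ => 0) y μ ν - 1‖ ≤ 0 := fun y μ ν => by
    simpa using norm_plaqC_expGauge_sub_one_le (P := P) 0 (fun _ => 0) y μ ν
  have hθθ : (((P.L : ℝ) ^ 1) ^ 2 * 0) ^ 2 ≤ 1 / 500 := by norm_num
  refine ⟨P, hPd, rfl, x, fun μ => (hxv μ).trans hv, fun f F hF => ?_⟩
  have h := M P hPd rfl 1 le_rfl le_rfl (by rw [hN0]; show 2 * (3 ^ 1 - 1) + 4 < 2 * (3 * 3 ^ m); omega) (expGauge P 0 fun _ => 0) 0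
    le_rfl hθ hθθ c0 M0 (fun _ => by rw [hM0]; norm_num) hfit0 (fun i => by rw [hM0, hN0]; show 3 ^ 1 * 22 < 2 * (3 * 3 ^ m); omega)
    1 33 le_rfl 31 1 0 (by show 10 * (3 : ℝ) ^ 1 < 31; norm_num) le_rfl one_pos (by push_cast; norm_num)
    (fun i => by
      rw [hM0, hN0]; show (((3 ^ 1 * 22 : ℕ)) : ℝ) + 31 ≤ ((2 * (3 * 3 ^ m) : ℕ) : ℝ)
      have hXr : (100 : ℝ) < (3 : ℝ) ^ m := hm
      push_cast; linarith)
    _ hΩ subset_rfl x hxmem hdeep f F 0 hF le_rfl (fun y _ => B5Ineq137Torus.T_nonneg P 0 x y)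
  subst hc0 hM0
  simpa using h

end Instance


end

end Literature.MathematicalPhysics.QuantumFieldTheory.BalabanImbrieJaffe1984to88.BIJ88DeltaLocSmallPlaquetteRegionCwt
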